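/-
Copyright (c) 2026. All rights reserved.
Released under Apache 2.0 license as described in the file LICENSE.
Authors: abc-iut cell, prover seat abc-iut-L4-t5 (gen 10; row «F3757-PORT», abc-iut-L4-lead m147 (5)), after abc-iut-f-101's
`LogFrobeniusMonoTelecoreObservablesOverBridge(.lean/TS)` (the mono-analytic twin), over file 5 of this mover; the generic moves
(`OverData.comapAlong`, `OverData.heq_of_eq`, `isOver_cast_iff`, `isOver_comapAlong_iff`) are this lineage's / abc-iut-L3's, BY NAME.
-/
import Literature.AnabelianGeometry.AbsoluteAnabelian.LogFrobeniusAnTelecoreObservablesSinks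
import Literature.AnabelianGeometry.AbsoluteAnabelian.LogFrobeniusObservablesOver
import Literature.AnabelianGeometry.AbsoluteAnabelian.LogFrobeniusObservablesTSOver
import Literature.AnabelianGeometry.AbsoluteAnabelian.AbsTopIII.FrobeniusPictureMLFLogTeleFamilyGlue
import Literature.AnabelianGeometry.AbsoluteAnabelian.DiagramShiftInvarianceLifts
import HarnessLib

/-!
# [AbsTopIII] Cor 5.5 (iii), last sentence, inside `D_{An•}`: «lies over `Th•[Z]`» — the observables' own over-data vs `D_{An•}`'s

S. Mochizuki, *Topics in absolute anabelian geometry III: global reconstruction algorithms*,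
J. Math. Sci. Univ. Tokyo 22 (2015) 939–1156 [MochizukiAbsTopIII2015]; manuscript `paper:url-5493eb38cbb7`: Rmk 3.5.1 p. 78
(structure functors: a core as «a sort of 'constant portion' of the diagram that lies, in a consistent fashion, 'under the
entire diagram'»), Def 5.4 (ii)/(iv) pp. 125–127 (`log`, `λ⊞_{v,ν}` lie over `Th•[Z]`), Cor 5.5 (iii) p. 131.

BRIDGE (row «F3757-PORT», file 9 of the mover) between the two presentations of «lies over `Th•[Z]`» used by the Cor 5.5 (iii)
compatibility closer (`cor55ObservablesTelecoreCompatible_of`, hypotheses `hoverPlus` / `hoverTS` read INSIDE `D_{An•}` against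
file 1's over-datum `anOverE`) and by its suppliers (abc-iut-w5-d144's `isOver_logObsFamily_η` / `isOver_logObsFamilyTS_η`, against
the observables' own over-data `logPlusOverE v` / `logTSOverE v`): along file 5's embeddings `plusEmb v`, `tsEmb v` the structure
functors and the over-isomorphisms of every arrow AGREE ON THE NOSE (`proj`, `𝒩⊞_v → 𝒩_v → Th•[Z]`, `𝒩_v → Th•[Z]`; `logOver`,
unitor, `lamOver`, identity — the same interface data on both sides: `logPlusOverE_heq_comapAlong`, `logTSOverE_heq_comapAlong`),
hence ★ `isOver_embPlusHomAn_of_isOver` / `isOver_embTSHomAn_of_isOver`: a homotopy of `S_log⊞_v` / `S_log_v` lying over `Th•[Z]`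
for the observable's over-datum lies, read in `D_{An•}`, over `Th•[Z]` for `anOverE` (transport along `F^*`,
`isOver_comapAlong_iff`, and along the identification of the diagrams, `isOver_cast_iff`).
OUR kernel bookkeeping; nothing here bears on [IUTchIII] Cor. 3.12; no side taken.
-/

set_option autoImplicit false

universe u

open CategoryTheory Quiver

namespace Literature.AnabelianGeometry.AbsoluteAnabelian

namespace LogFrobeniusSetting

open DiagramOfCategories

variable {Vmod : Type u} {isArc : Vmod → Bool} (L : LogFrobeniusSetting Vmod isArc) (v : Vmod)

/-! ## `⊞` -/

/-- **The observable's over-datum IS `D_{An•}`'s pulled back along `plusEmb`** (structure functors `proj` on `D•_{≤2}`,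
`𝒩⊞_v → 𝒩_v → Th•[Z]` at `𝒩⊞_v`; over-isomorphisms `logOver`, unitor, `lamOver` — equal data, vertex by vertex and arrow by arrow).
[cite: MochizukiAbsTopIII2015, Remark 3.5.1 p.78] -/
theorem logPlusOverE_heq_comapAlong :
    HEq (L.logPlusOverE v) (L.anOverE.comapAlong (plusEmb (Vmod := Vmod) (isArc := isArc) v)) := by
  refine OverData.heq_of_eq (L.logDiagramPlus_eq_comapAlongAn v) (fun a => ?_) (fun a b e => ?_)
  · rcases a with ⟨c, hc⟩ | _
    · cases c <;> first | exact HEq.rfl | exact absurd hc.2 (by simp [DVertex.row])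
    · exact HEq.rfl
  · rcases a with ⟨c, hc⟩ | _ <;> rcases b with ⟨d, hd⟩ | _
    · change DEdge isArc c d at e
      cases e with
      | log n => exact HEq.rfl
      | toCore n => exact HEq.rfl
      | lam w ν hν => exact absurd hd.2 (by simp [DVertex.row])
      | forget w => exact absurd hc.2 (by simp [DVertex.row])
      | toE w => exact absurd hc.2 (by simp [DVertex.row])
      | κAn => exact absurd hc.2 (by simp [DVertex.row])
      | anToE => exact absurd hc.2 (by simp [DVertex.row])
      | monoNplus w => exact hd.1.elim
      | monoN w => exact hd.1.elim
      | monoE5 => exact hd.1.elim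
      | monoAn => exact hd.1.elim
      | monoE7 => exact hd.1.elim
      | forgetMono w => exact hc.1.elim
      | toEmono w => exact hc.1.elim
      | κAnMono => exact hc.1.elim
      | anMonoToE => exact hc.1.elim
    · change DEdge isArc c (.nplus v) at e
      cases e with
      | lam w ν hν => exact HEq.rfl
    · exact PEmpty.elim e
    · exact PEmpty.elim e

/-- ★ **BRIDGE (`⊞`)**: a homotopy of `S_log⊞_v` into `𝒩⊞_v` lying over `Th•[Z]` for the observable's own over-datum
(abc-iut-w5-d144's `logPlusOverE v`) lies, read in `D_{An•}` (file 5's `embPlusHomAn`), over `Th•[Z]` for file 1's `anOverE` — the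
hypothesis `hoverPlus` of `cor55ObservablesTelecoreCompatible_of`, from abc-iut-w5-d144's `isOver_logObsFamily_η`.
[cite: MochizukiAbsTopIII2015, Remark 3.5.1 p.78] -/
theorem isOver_embPlusHomAn_of_isOver (H : (L.logDiagramPlus v).HomotopyFamily) {a : (logShapePlus (isArc := isArc) v).Vertex}
    {p q : Path a (logShapePlus (isArc := isArc) v).obs} (h : H.E p q) (ho : (L.logPlusOverE v).IsOver p q (H.η h)) :
    L.anOverE.IsOver ((plusEmb (Vmod := Vmod) (isArc := isArc) v).mapPath p)
      ((plusEmb (Vmod := Vmod) (isArc := isArc) v).mapPath q) (L.embPlusHomAn v H h) := by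
  have mem : (L.plusComapAn v H).E p q := (L.plusComapAn_E_iff v H p q).mpr h
  have hθ : HEq (H.η h) ((L.plusComapAn v H).η mem) := (L.plusComapAn_η_heq v H mem).symm
  have h1 : (L.anOverE.comapAlong (plusEmb (Vmod := Vmod) (isArc := isArc) v)).IsOver p q ((L.plusComapAn v H).η mem) :=
    (OverData.isOver_cast_iff (L.logDiagramPlus_eq_comapAlongAn v) (L.logPlusOverE_heq_comapAlong v) hθ).mp ho
  rw [embPlusHomAn, LiftPair.hom_ofMem]
  exact (OverData.isOver_comapAlong_iff L.anOverE (plusEmb v) p q _).mp h1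

/-- The hypothesis `hoverPlus` of `cor55ObservablesTelecoreCompatible_of`, from over-ness for the observables' own over-data at
every `v`. [cite: MochizukiAbsTopIII2015, Remark 3.5.1 p.78] -/
theorem hoverPlus_of_isOver (Hplus : ∀ v : Vmod, (L.logDiagramPlus v).HomotopyFamily)
    (ho : ∀ (v : Vmod) {a b : (logShapePlus (isArc := isArc) v).Vertex} {p q : Path a b} (h : (Hplus v).E p q),
      (L.logPlusOverE v).IsOver p q ((Hplus v).η h))
    (w : Vmod) (a : (logShapePlus (isArc := isArc) w).Vertex) (p q : Path a (logShapePlus (isArc := isArc) w).obs)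
    (h : (Hplus w).E p q) :
    L.anOverE.IsOver ((plusEmb (Vmod := Vmod) (isArc := isArc) w).mapPath p)
      ((plusEmb (Vmod := Vmod) (isArc := isArc) w).mapPath q) (L.embPlusHomAn w (Hplus w) h) :=
  L.isOver_embPlusHomAn_of_isOver w (Hplus w) h (ho w h)

/-! ## `TS` -/

/-- **The `TS`-observable's over-datum IS `D_{An•}`'s pulled back along `tsEmb`**. [cite: MochizukiAbsTopIII2015, Remark 3.5.1 p.78] -/
theorem logTSOverE_heq_comapAlong :
    HEq (L.logTSOverE v) (L.anOverE.comapAlong (tsEmb (Vmod := Vmod) (isArc := isArc) v)) := by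
  refine OverData.heq_of_eq (L.logDiagramTS_eq_comapAlongAn v) (fun a => ?_) (fun a b e => ?_)
  · rcases a with ⟨c, hc⟩ | _
    · have hrow : ¬ c.InFirstRows 2 → c ≠ .nplus v → False := fun h₁ h₂ => by
        rcases hc with hc | hc <;> [exact h₁ hc; exact h₂ hc]
      cases c with
      | row1 n => exact HEq.rfl
      | core => exact HEq.rfl
      | nplus w => exact HEq.rfl
      | nv w => exact (hrow (fun h => absurd h.2 (by simp [DVertex.row])) (fun h => by cases h)).elim
      | e5 => exact (hrow (fun h => absurd h.2 (by simp [DVertex.row])) (fun h => by cases h)).elim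
      | an => exact (hrow (fun h => absurd h.2 (by simp [DVertex.row])) (fun h => by cases h)).elim
      | e7 => exact (hrow (fun h => absurd h.2 (by simp [DVertex.row])) (fun h => by cases h)).elim
      | nmonoPlus w => exact (hrow (fun h => h.1.elim) (fun h => by cases h)).elim
      | nmono w => exact (hrow (fun h => h.1.elim) (fun h => by cases h)).elim
      | emono5 => exact (hrow (fun h => h.1.elim) (fun h => by cases h)).elim
      | anMono => exact (hrow (fun h => h.1.elim) (fun h => by cases h)).elim
      | emono7 => exact (hrow (fun h => h.1.elim) (fun h => by cases h)).elim
    · exact HEq.rfl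
  · rcases a with ⟨c, hc⟩ | _ <;> rcases b with ⟨d, hd⟩ | _
    · change DEdge isArc c d at e
      cases e with
      | log n => exact HEq.rfl
      | toCore n => exact HEq.rfl
      | lam w ν hν =>
        rcases hd with hd | hd
        · exact absurd hd.2 (by simp [DVertex.row])
        · cases hd; exact HEq.rfl
      | forget w => rcases hd with hd | hd <;> [exact absurd hd.2 (by simp [DVertex.row]); cases hd]
      | toE w => rcases hc with hc | hc <;> [exact absurd hc.2 (by simp [DVertex.row]); cases hc]
      | κAn => rcases hc with hc | hc <;> [exact absurd hc.2 (by simp [DVertex.row]); cases hc]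
      | anToE => rcases hc with hc | hc <;> [exact absurd hc.2 (by simp [DVertex.row]); cases hc]
      | monoNplus w => rcases hd with hd | hd <;> [exact hd.1.elim; cases hd]
      | monoN w => rcases hd with hd | hd <;> [exact hd.1.elim; cases hd]
      | monoE5 => rcases hd with hd | hd <;> [exact hd.1.elim; cases hd]
      | monoAn => rcases hd with hd | hd <;> [exact hd.1.elim; cases hd]
      | monoE7 => rcases hd with hd | hd <;> [exact hd.1.elim; cases hd]
      | forgetMono w => rcases hc with hc | hc <;> [exact hc.1.elim; cases hc]
      | toEmono w => rcases hc with hc | hc <;> [exact hc.1.elim; cases hc]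
      | κAnMono => rcases hc with hc | hc <;> [exact hc.1.elim; cases hc]
      | anMonoToE => rcases hc with hc | hc <;> [exact hc.1.elim; cases hc]
    · change DEdge isArc c (.nv v) at e
      cases e with
      | forget w => exact HEq.rfl
    · exact PEmpty.elim e
    · exact PEmpty.elim e

/-- ★ **BRIDGE (`TS`)**: a homotopy of `S_log_v` into `𝒩_v` lying over `Th•[Z]` for abc-iut-w5-d144's `logTSOverE v` lies, read in
`D_{An•}` (`embTSHomAn`), over `Th•[Z]` for `anOverE` — the hypothesis `hoverTS`, from abc-iut-w5-d144's `isOver_logObsFamilyTS_η`.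
[cite: MochizukiAbsTopIII2015, Remark 3.5.1 p.78] -/
theorem isOver_embTSHomAn_of_isOver (H : (L.logDiagramTS v).HomotopyFamily) {a : (logShapeTS (isArc := isArc) v).Vertex}
    {p q : Path a (logShapeTS (isArc := isArc) v).obs} (h : H.E p q) (ho : (L.logTSOverE v).IsOver p q (H.η h)) :
    L.anOverE.IsOver ((tsEmb (Vmod := Vmod) (isArc := isArc) v).mapPath p)
      ((tsEmb (Vmod := Vmod) (isArc := isArc) v).mapPath q) (L.embTSHomAn v H h) := by
  have mem : (L.tsComapAn v H).E p q := (L.tsComapAn_E_iff v H p q).mpr h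
  have hθ : HEq (H.η h) ((L.tsComapAn v H).η mem) := (L.tsComapAn_η_heq v H mem).symm
  have h1 : (L.anOverE.comapAlong (tsEmb (Vmod := Vmod) (isArc := isArc) v)).IsOver p q ((L.tsComapAn v H).η mem) :=
    (OverData.isOver_cast_iff (L.logDiagramTS_eq_comapAlongAn v) (L.logTSOverE_heq_comapAlong v) hθ).mp ho
  rw [embTSHomAn, LiftPair.hom_ofMem]
  exact (OverData.isOver_comapAlong_iff L.anOverE (tsEmb v) p q _).mp h1

/-- The hypothesis `hoverTS` of `cor55ObservablesTelecoreCompatible_of`, from over-ness for the `TS`-observables' own over-data.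
[cite: MochizukiAbsTopIII2015, Remark 3.5.1 p.78] -/
theorem hoverTS_of_isOver (Hts : ∀ v : Vmod, (L.logDiagramTS v).HomotopyFamily)
    (ho : ∀ (v : Vmod) {a b : (logShapeTS (isArc := isArc) v).Vertex} {p q : Path a b} (h : (Hts v).E p q),
      (L.logTSOverE v).IsOver p q ((Hts v).η h))
    (w : Vmod) (a : (logShapeTS (isArc := isArc) w).Vertex) (p q : Path a (logShapeTS (isArc := isArc) w).obs)
    (h : (Hts w).E p q) :
    L.anOverE.IsOver ((tsEmb (Vmod := Vmod) (isArc := isArc) w).mapPath p)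
      ((tsEmb (Vmod := Vmod) (isArc := isArc) w).mapPath q) (L.embTSHomAn w (Hts w) h) :=
  L.isOver_embTSHomAn_of_isOver w (Hts w) h (ho w h)

end LogFrobeniusSetting

end Literature.AnabelianGeometry.AbsoluteAnabelian
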